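import Summits.BirchSwinnertonDyer.Rank1Residual.X2.NonPrimitiveSelmerGVEquality
import Summits.BirchSwinnertonDyer.Rank1Residual.X2.NonPrimitiveSelmerDual
import Summits.BirchSwinnertonDyer.Rank1Residual.X2.NonPrimitiveSelmerTorsionCard
import Summits.BirchSwinnertonDyer.Rank1Residual.X2.GreenbergVatsalTransferCurve
import Literature.NumberTheory.EllipticCurves.GreenbergVatsal2000.NonPrimitiveLambdaInvariant
import Literature.NumberTheory.EllipticCurves.GreenbergVatsal2000.NonPrimitiveSelmerDivisible
import HarnessLib

/-!
# Route G's typed input `CongruentLambdaShift` DERIVED: `λ(E₁) = λ(E₂) + Σ_{ℓ∈Σ₀} s_ℓ (d_ℓ(E₂) − d_ℓ(E₁))`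
# for `E₁[p] ≅ E₂[p]` at a good ordinary odd `p` with `μ = 0` (Greenberg–Vatsal 2000, Thm. (1.4)/p. 27),
# from TWO printed §1–§2 statements and the cell's kernel

HONEST FRAMING (BSD rank-`≤ 1` residual cell `b2b-bsdres`, home
`run/shared/lean/b2b/bsd-rank1-residual/`, unit `b2b-bsdres-eisenstein-p2`, class X2; research route,
no claim beyond stated classes; nothing booked here; labels unchanged): the cell deletes the
COMBINATION-SHAPED residual classes of the rank-`≤ 1` BSD formula from PUBLISHED theorems only and
TYPES the construction-shaped ones; this is not "finishing BSD". Theorems only (no definition, no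
named fact, nothing asserted). Route G of the X1 (r = 0) and X2 attacks
(`X1/CongruenceTransfer.lean`, `X2/CongruenceTransfer*.lean`) consumes the TYPED input
`X1.CongruenceTransfer.CongruentLambdaShift W W' p e` — "if `E[p] ≅ E'[p]` then `λ(E) = λ(E') + e`
at `μ = 0`" — whose instances were so far supplied per pair OUTSIDE the kernel by the census
(eisenstein-p1's `congr3.py`, this seat's `routeG/`). This file PROVES it, with the shift `e` made
EXPLICIT:

  `e = Σ_{v ∈ Σ₀} (δ_{E'}^{(v)} − δ_E^{(v)})`, `δ_E^{(v)} = s_ℓ · d_ℓ(E)` (GV Prop. (2.4);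
  `GreenbergVatsal2000.delta`, read off Mathlib's `localPolynomialAt` mod `p`),

for `E, E'/ℚ` globally minimal, `p` ODD and good ORDINARY for both, `Σ₀` any finite set of primes
`∌ p` containing the bad primes of both — CONDITIONAL on exactly three PRINTED statements, all
Literature named facts with locators (hypotheses `hGV`, `hA`, `hB`):

* `GreenbergVatsal2000.imKummer_ge_greenbergCondition_at_p` (GV p. 26 ← Greenberg LNM 1716
  Props. 2.2/2.4: `L_𝔭 ⊆ im κ_𝔭`; gen 10, p221999);
* `GreenbergVatsal2000.lambda_nonPrimitive_eq_add_sum_delta` (GV (7): `λ_{E,Σ₀} = λ_E + Σ δ`,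
  `μ_{E,Σ₀} = μ_E`; Cor. (2.3) + Prop. (2.4));
* `GreenbergVatsal2000.divisible_nonPrimitiveSelmerInfty_of_mu_eq_zero` (GV p. 8 / Prop. (2.5),
  proof of (2.8): `Sel^{Σ₀}_E(ℚ_∞)_p` is divisible at `μ = 0`),

and otherwise on tree THEOREMS only: the Pontryagin algebra `#S[p] = p^{λ(X)}`
(`NonPrimitiveSelmerTorsionCard`), `Sel^{Σ₀}_E(ℚ_∞)_p = S^{Σ₀}_{E[p^∞]}(ℚ_∞)`
(`NonPrimitiveSelmerGVEquality`, GV p. 26), the existence of the dual datum (`NonPrimitiveSelmerDual`),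
and gens 8–9's kernel form of GV Prop. (2.8)/p. 27 "the order of `S^{Σ₀}_{A_i}(ℚ_∞)[p]` is
independent of `i`" (`GreenbergVatsalTransferCurve.natCard_gvSelmerInfty_inf_torsion_eq_of_torsionIso`,
NO `H⁰` hypothesis).

## Main results

* §1 **`finite_and_natCard_torsionBy_nonPrimitiveSelmerInfty_eq_pow`** — one curve: at `μ = 0`,
  `Sel^{Σ₀}_E(ℚ_∞)_p[p]` is finite of order `p ^ (λ(E) + Σ_{v∈Σ₀} δ_E^{(v)})` (GV p. 8
  "`λ_{E,Σ₀} = dim_{𝔽_p} Sel^{Σ₀}_E(ℚ_∞)_p[p]`" with (7) substituted);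
  **`natCard_gvSelmerInfty_inf_torsionBy_eq_pow`** — the same for the kernel's object
  `S^{Σ₀}_{E[p^∞]}(ℚ_∞) ⊓ H¹[p]` (the input eisenstein-p1's route D witnesses bound from below).
* §2 **`lambda_add_sum_delta_eq_of_torsionIso`** — two congruent curves: `λ(E₁) + Σ δ₁ = λ(E₂) + Σ δ₂`.
* §3 **`congruentLambdaShift_of_facts`** — `CongruentLambdaShift W₁ W₂ p (Σ_{v∈Σ₀} (δ₂ − δ₁))`.

References: R. Greenberg, V. Vatsal, Invent. Math. 142 (2000) 17–63: §1 (5)–(7) pp. 7–8, Thm. (1.4),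
§2 Cor. (2.3), Prop. (2.4), (2.5), (2.8), pp. 26–27 ("if `μ_{E₁} = 0`, then `μ_{E₂} = 0` and
`λ_{E₂,Σ₀} = λ_{E₁,Σ₀}`"; worked example p. 27: `52A1`/`364A1`, `p = 5`, `δ^{(7)} = 5·1`).
-/

noncomputable section

open scoped Classical AddSubgroup

namespace Summit.BirchSwinnertonDyer.Rank1Residual.X2.CongruentLambdaShiftDerived

open NumberField IsDedekindDomain Field Literature.NumberTheory.GaloisRepresentations
  Literature.NumberTheory.EllipticCurves Literature.NumberTheory.EllipticCurves.GreenbergSelmer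
  Literature.NumberTheory.EllipticCurves.GreenbergVatsal2000
  Summit.BirchSwinnertonDyer.Rank1Residual.X2.GreenbergVatsalTorsion
  Summit.BirchSwinnertonDyer.Rank1Residual.X2.GreenbergVatsalReductionDatum
  Summit.BirchSwinnertonDyer.Rank1Residual.X2.GreenbergVatsalTransferCurve
  Summit.BirchSwinnertonDyer.Rank1Residual.X2.NonPrimitiveSelmerGVEquality
  Summit.BirchSwinnertonDyer.Rank1Residual.X2.NonPrimitiveSelmerDual
  Summit.BirchSwinnertonDyer.Rank1Residual.X2.NonPrimitiveSelmerTorsionCard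

open WeierstrassCurve (minimalDiscriminantInt)

/-! ## §1. One curve: `#Sel^{Σ₀}_E(ℚ_∞)_p[p] = p ^ (λ(E) + Σ_{v∈Σ₀} δ_E^{(v)})` at `μ = 0` -/

section OneCurve

variable (W : WeierstrassCurve ℚ) [W.IsElliptic] [W.IsGloballyMinimal] {p : ℕ} [Fact p.Prime]
  {κ : ZpExtension ℚ p} {γ : absoluteGaloisGroup ℚ} (S₀ : Finset (HeightOneSpectrum (𝓞 ℚ)))

/-- **`Sel^{Σ₀}_E(ℚ_∞)_p[p]` is finite of order `p ^ (λ(E) + Σ_{v∈Σ₀} δ_E^{(v)})`.** `E/ℚ` globally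
minimal, `p` odd good ordinary, `κ` cyclotomic with topological generator `γ`, `Σ₀ ∌ p` containing
the bad primes, `D` any Pontryagin-dual datum of `Sel_{p^∞}(E/ℚ_∞)` with `D.X` finitely generated,
`Λ`-torsion and `μ = 0`. From GV (7) (`hA`: the dual `X^{Σ₀}` of `Sel^{Σ₀}` — which exists,
`nonPrimitiveDualData` — is f.g. torsion with `μ = 0` and `λ = λ(E) + Σ δ`) and GV p. 8 (`hB`:
`Sel^{Σ₀}` is divisible), by the Pontryagin count `#S[p] = p^{λ(X)}`
(`finite_and_natCard_torsionBy_eq_pow_lambdaInvariant_of_divisible`).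
[cite: GreenbergVatsal2000, §1 (7) and p. 8] -/
theorem finite_and_natCard_torsionBy_nonPrimitiveSelmerInfty_eq_pow
    (hA : lambda_nonPrimitive_eq_add_sum_delta) (hB : divisible_nonPrimitiveSelmerInfty_of_mu_eq_zero)
    (hp2 : p ≠ 2) (hgood : W.HasGoodReductionAtPrime p) (hord : ¬ (p : ℤ) ∣ W.frobeniusTrace p)
    (hκ : κ.IsCyclotomic) (hγ : κ.IsTopGenerator γ)
    (hS₀ : ∀ v ∈ S₀, ((p : ℕ) : 𝓞 ℚ) ∉ v.asIdeal)
    (hbad : ∀ v : HeightOneSpectrum (𝓞 ℚ), v ∉ S₀ → ((p : ℕ) : 𝓞 ℚ) ∉ v.asIdeal →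
      W.HasGoodReductionAt v)
    (D : W.SelmerDualData κ γ) [Module.Finite (IwasawaAlgebra p) D.X] (hX : D.IsTorsion)
    (hμ : D.mu = 0) :
    Finite ((nonPrimitiveSelmerInfty W κ (↑S₀ : Set (HeightOneSpectrum (𝓞 ℚ))))[(p : ℤ)]) ∧
      Nat.card ((nonPrimitiveSelmerInfty W κ (↑S₀ : Set (HeightOneSpectrum (𝓞 ℚ))))[(p : ℤ)]) =
        p ^ (lambdaInvariant p D.X + ∑ v ∈ S₀, delta W p v) := by
  set DS := nonPrimitiveDualData W κ (↑S₀ : Set (HeightOneSpectrum (𝓞 ℚ))) hγ with hDS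
  obtain ⟨hfg, htors, hmu, hlam⟩ :=
    hA W p hp2 hgood hord κ hκ γ hγ S₀ hS₀ D DS hX
  haveI := hfg
  have hμS : muInvariant p DS.X = 0 := by rw [hmu]; exact hμ
  have hdiv : ∀ s : nonPrimitiveSelmerInfty W κ (↑S₀ : Set (HeightOneSpectrum (𝓞 ℚ))),
      ∃ t : nonPrimitiveSelmerInfty W κ (↑S₀ : Set (HeightOneSpectrum (𝓞 ℚ))), p • t = s := by
    intro s
    obtain ⟨t, ht, hts⟩ := hB W p hp2 hgood hord κ hκ γ hγ S₀ hS₀ (fun v hv hpv ↦ hbad v hv hpv)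
      D hX hμ s s.2
    exact ⟨⟨t, ht⟩, Subtype.ext (by rw [AddSubgroupClass.coe_nsmul]; exact hts)⟩
  have key := finite_and_natCard_torsionBy_eq_pow_lambdaInvariant_of_divisible p DS.X htors hμS
    hdiv (toDualEquiv W κ _ DS)
  rw [hlam] at key
  exact key

/-- **The same for the kernel's object `S^{Σ₀}_{E[p^∞]}(ℚ_∞) ⊓ H¹(ℚ_∞, E[p^∞])[p]`** (Greenberg's
data `C_p = ker(E[p^∞] → Ẽ)`): `#(S^{Σ₀} ⊓ H¹[p]) = p ^ (λ(E) + Σ_{v∈Σ₀} δ_E^{(v)})`, via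
`Sel^{Σ₀}_E(ℚ_∞)_p = S^{Σ₀}_{E[p^∞]}(ℚ_∞)` (GV p. 26; `hGV`). This is the quantity eisenstein-p1's
route D bounds from below by finite-layer descent witnesses, and the two sides of the kernel
transfer. [cite: GreenbergVatsal2000, §1 (7), p. 8 and §2 pp. 26–27] -/
theorem natCard_gvSelmerInfty_inf_torsionBy_eq_pow (hGV : imKummer_ge_greenbergCondition_at_p)
    (hA : lambda_nonPrimitive_eq_add_sum_delta) (hB : divisible_nonPrimitiveSelmerInfty_of_mu_eq_zero)
    (hp2 : p ≠ 2) (hgood : W.HasGoodReductionAtPrime p) (hord : ¬ (p : ℤ) ∣ W.frobeniusTrace p)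
    (hκ : κ.IsCyclotomic) (hγ : κ.IsTopGenerator γ)
    (hS₀ : ∀ v ∈ S₀, ((p : ℕ) : 𝓞 ℚ) ∉ v.asIdeal)
    (hbad : ∀ v : HeightOneSpectrum (𝓞 ℚ), v ∉ S₀ → ((p : ℕ) : 𝓞 ℚ) ∉ v.asIdeal →
      W.HasGoodReductionAt v)
    (D : W.SelmerDualData κ γ) [Module.Finite (IwasawaAlgebra p) D.X] (hX : D.IsTorsion)
    (hμ : D.mu = 0) (hΔ : ¬ (p : ℤ) ∣ minimalDiscriminantInt W) :
    Nat.card (gvSelmerInfty κ (W.geomPrimaryTorsion p) (reductionData W p hΔ)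
        (↑S₀ : Set (HeightOneSpectrum (𝓞 ℚ))) ⊓
        (subgroupH1 κ.kerSubgroup (W.geomPrimaryTorsion p))[(p : ℤ)] :
        AddSubgroup (subgroupH1 κ.kerSubgroup (W.geomPrimaryTorsion p))) =
      p ^ (lambdaInvariant p D.X + ∑ v ∈ S₀, delta W p v) := by
  rw [← natCard_torsionBy_nonPrimitiveSelmerInfty_eq W p κ _ hGV hp2 hΔ hord hκ hS₀ hbad]
  exact (finite_and_natCard_torsionBy_nonPrimitiveSelmerInfty_eq_pow W S₀ hA hB hp2 hgood hord hκ
    hγ hS₀ hbad D hX hμ).2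

end OneCurve

/-! ## §2. Two congruent curves: `λ(E₁) + Σ δ₁ = λ(E₂) + Σ δ₂` -/

section TwoCurves

variable (W₁ W₂ : WeierstrassCurve ℚ) [W₁.IsElliptic] [W₁.IsGloballyMinimal] [W₂.IsElliptic]
  [W₂.IsGloballyMinimal] {p : ℕ} [Fact p.Prime] {κ : ZpExtension ℚ p}
  {γ : absoluteGaloisGroup ℚ} (S₀ : Finset (HeightOneSpectrum (𝓞 ℚ)))

/-- **`λ(E₁) + Σ_{v∈Σ₀} δ_{E₁}^{(v)} = λ(E₂) + Σ_{v∈Σ₀} δ_{E₂}^{(v)}`** for `E₁[p] ≅ E₂[p]`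
(`TorsionIso`), `p` odd and good ordinary for both, `κ` cyclotomic, `Σ₀ ∌ p` containing the bad
primes of both, `μ(E₁) = μ(E₂) = 0` (any f.g. torsion dual data `D₁`, `D₂`): both sides are
`log_p #(S^{Σ₀}_{E_i[p^∞]}(ℚ_∞) ⊓ H¹[p])` (§1), and these orders agree by the kernel transfer
`natCard_gvSelmerInfty_inf_torsion_eq_of_torsionIso` (GV p. 27 "independent of `i`"). This is GV
p. 27 "`λ_{E₂,Σ₀} = λ_{E₁,Σ₀}`" with (7) substituted on both sides.
[cite: GreenbergVatsal2000, Thm. (1.4) and §2 pp. 26–27] -/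
theorem lambda_add_sum_delta_eq_of_torsionIso (hGV : imKummer_ge_greenbergCondition_at_p)
    (hA : lambda_nonPrimitive_eq_add_sum_delta) (hB : divisible_nonPrimitiveSelmerInfty_of_mu_eq_zero)
    (hp2 : p ≠ 2) (hgood₁ : W₁.HasGoodReductionAtPrime p) (hord₁ : ¬ (p : ℤ) ∣ W₁.frobeniusTrace p)
    (hgood₂ : W₂.HasGoodReductionAtPrime p) (hord₂ : ¬ (p : ℤ) ∣ W₂.frobeniusTrace p)
    (hκ : κ.IsCyclotomic) (hγ : κ.IsTopGenerator γ)
    (hS₀ : ∀ v ∈ S₀, ((p : ℕ) : 𝓞 ℚ) ∉ v.asIdeal)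
    (hS₁ : ∀ v : HeightOneSpectrum (𝓞 ℚ), v ∉ S₀ → ((p : ℕ) : 𝓞 ℚ) ∉ v.asIdeal →
      W₁.HasGoodReductionAt v)
    (hS₂ : ∀ v : HeightOneSpectrum (𝓞 ℚ), v ∉ S₀ → ((p : ℕ) : 𝓞 ℚ) ∉ v.asIdeal →
      W₂.HasGoodReductionAt v)
    (hiso : X1.CongruenceTransfer.TorsionIso W₁ W₂ p)
    (D₁ : W₁.SelmerDualData κ γ) (D₂ : W₂.SelmerDualData κ γ)
    [Module.Finite (IwasawaAlgebra p) D₁.X] [Module.Finite (IwasawaAlgebra p) D₂.X]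
    (hX₁ : D₁.IsTorsion) (hX₂ : D₂.IsTorsion) (hμ₁ : D₁.mu = 0) (hμ₂ : D₂.mu = 0) :
    lambdaInvariant p D₁.X + ∑ v ∈ S₀, delta W₁ p v =
      lambdaInvariant p D₂.X + ∑ v ∈ S₀, delta W₂ p v := by
  have h₁ := natCard_gvSelmerInfty_inf_torsionBy_eq_pow W₁ S₀ hGV hA hB hp2 hgood₁ hord₁ hκ hγ hS₀
    hS₁ D₁ hX₁ hμ₁ (W₁.not_dvd_minimalDiscriminantInt_of_hasGoodReductionAtPrime' p hgood₁)
  have h₂ := natCard_gvSelmerInfty_inf_torsionBy_eq_pow W₂ S₀ hGV hA hB hp2 hgood₂ hord₂ hκ hγ hS₀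
    hS₂ D₂ hX₂ hμ₂ (W₂.not_dvd_minimalDiscriminantInt_of_hasGoodReductionAtPrime' p hgood₂)
  have ht := natCard_gvSelmerInfty_inf_torsion_eq_of_torsionIso W₁ W₂ κ
    (↑S₀ : Set (HeightOneSpectrum (𝓞 ℚ))) hp2 hgood₁ hord₁ hgood₂ hord₂ hκ hS₁ hS₂ hiso
  rw [h₁, h₂] at ht
  exact Nat.pow_right_injective (Fact.out : p.Prime).two_le ht

end TwoCurves

/-! ## §3. `CongruentLambdaShift` derived -/

section Derived

variable (W₁ W₂ : WeierstrassCurve ℚ) [W₁.IsElliptic] [W₁.IsGloballyMinimal] [W₂.IsElliptic]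
  [W₂.IsGloballyMinimal] (p : ℕ) [Fact p.Prime] (S₀ : Finset (HeightOneSpectrum (𝓞 ℚ)))

/-- **Route G's typed input DERIVED: `CongruentLambdaShift W₁ W₂ p e` with
`e = Σ_{v∈Σ₀} (δ_{E₂}^{(v)} − δ_{E₁}^{(v)})`, `δ^{(v)}_E = s_ℓ d_ℓ(E)`.** For `E₁, E₂/ℚ` globally minimal,
`p` ODD and good ORDINARY for both, `Σ₀` a finite set of primes `∌ p` containing the bad primes of
both: IF `E₁[p] ≅ E₂[p]` (`TorsionIso`) THEN for the cyclotomic `ℤ_p`-extension, every topological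
generator `γ` (normalised or not) and all finitely generated `Λ`-torsion dual data `D₁`, `D₂` with
`μ = 0`: `λ(D₁.X) = λ(D₂.X) + Σ_{v∈Σ₀} (δ_{E₂}^{(v)} − δ_{E₁}^{(v)})` — Greenberg–Vatsal's Thm. (1.4)
mechanism (p. 27) in the kernel, conditional on the three printed statements `hGV` (GV p. 26 /
Greenberg Props. 2.2, 2.4), `hA` (GV (7)), `hB` (GV p. 8 / Prop. (2.5), (2.8)).
[cite: GreenbergVatsal2000, Thm. (1.4), §1 (7) p. 8, §2 Cor. (2.3), Props. (2.4), (2.5), (2.8), pp. 26–27] -/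
theorem congruentLambdaShift_of_facts (hGV : imKummer_ge_greenbergCondition_at_p)
    (hA : lambda_nonPrimitive_eq_add_sum_delta) (hB : divisible_nonPrimitiveSelmerInfty_of_mu_eq_zero)
    (hp2 : p ≠ 2) (hgood₁ : W₁.HasGoodReductionAtPrime p) (hord₁ : ¬ (p : ℤ) ∣ W₁.frobeniusTrace p)
    (hgood₂ : W₂.HasGoodReductionAtPrime p) (hord₂ : ¬ (p : ℤ) ∣ W₂.frobeniusTrace p)
    (hS₀ : ∀ v ∈ S₀, ((p : ℕ) : 𝓞 ℚ) ∉ v.asIdeal)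
    (hS₁ : ∀ v : HeightOneSpectrum (𝓞 ℚ), v ∉ S₀ → ((p : ℕ) : 𝓞 ℚ) ∉ v.asIdeal →
      W₁.HasGoodReductionAt v)
    (hS₂ : ∀ v : HeightOneSpectrum (𝓞 ℚ), v ∉ S₀ → ((p : ℕ) : 𝓞 ℚ) ∉ v.asIdeal →
      W₂.HasGoodReductionAt v) :
    X1.CongruenceTransfer.CongruentLambdaShift W₁ W₂ p
      (∑ v ∈ S₀, ((delta W₂ p v : ℤ) - (delta W₁ p v : ℤ))) := by
  intro hiso κ γ hκ hγ _hγ' D₁ D₂ _ _ hX₁ hX₂ hμ₁ hμ₂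
  have h := lambda_add_sum_delta_eq_of_torsionIso W₁ W₂ S₀ hGV hA hB hp2 hgood₁ hord₁ hgood₂ hord₂
    hκ hγ hS₀ hS₁ hS₂ hiso D₁ D₂ hX₁ hX₂ hμ₁ hμ₂
  rw [Finset.sum_sub_distrib]
  have h' : ((lambdaInvariant p D₁.X + ∑ v ∈ S₀, delta W₁ p v : ℕ) : ℤ) =
      ((lambdaInvariant p D₂.X + ∑ v ∈ S₀, delta W₂ p v : ℕ) : ℤ) := by rw [h]
  push_cast at h'
  linarith

/-- **The shift vanishes outside the places where the Euler factors differ mod `p`**: if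
`δ_{E₁}^{(v)} = δ_{E₂}^{(v)}` for every `v ∈ Σ₀` then `CongruentLambdaShift W₁ W₂ p 0`, i.e.
`λ(E₁) = λ(E₂)` (GV p. 27: "Note that `E[p]` does not determine `λ_E`" — it does once the local
invariants agree). [cite: GreenbergVatsal2000, Thm. (1.4) and p. 27] -/
theorem congruentLambdaShift_zero_of_facts (hGV : imKummer_ge_greenbergCondition_at_p)
    (hA : lambda_nonPrimitive_eq_add_sum_delta) (hB : divisible_nonPrimitiveSelmerInfty_of_mu_eq_zero)
    (hp2 : p ≠ 2) (hgood₁ : W₁.HasGoodReductionAtPrime p) (hord₁ : ¬ (p : ℤ) ∣ W₁.frobeniusTrace p)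
    (hgood₂ : W₂.HasGoodReductionAtPrime p) (hord₂ : ¬ (p : ℤ) ∣ W₂.frobeniusTrace p)
    (hS₀ : ∀ v ∈ S₀, ((p : ℕ) : 𝓞 ℚ) ∉ v.asIdeal)
    (hS₁ : ∀ v : HeightOneSpectrum (𝓞 ℚ), v ∉ S₀ → ((p : ℕ) : 𝓞 ℚ) ∉ v.asIdeal →
      W₁.HasGoodReductionAt v)
    (hS₂ : ∀ v : HeightOneSpectrum (𝓞 ℚ), v ∉ S₀ → ((p : ℕ) : 𝓞 ℚ) ∉ v.asIdeal →
      W₂.HasGoodReductionAt v)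
    (hδ : ∀ v ∈ S₀, delta W₁ p v = delta W₂ p v) :
    X1.CongruenceTransfer.CongruentLambdaShift W₁ W₂ p 0 := by
  have h := congruentLambdaShift_of_facts W₁ W₂ p S₀ hGV hA hB hp2 hgood₁ hord₁ hgood₂ hord₂ hS₀
    hS₁ hS₂
  have h0 : (∑ v ∈ S₀, ((delta W₂ p v : ℤ) - (delta W₁ p v : ℤ))) = 0 :=
    Finset.sum_eq_zero fun v hv ↦ by rw [hδ v hv, sub_self]
  rwa [h0] at h

end Derived

end Summit.BirchSwinnertonDyer.Rank1Residual.X2.CongruentLambdaShiftDerived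

end
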